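import Mathlib
import HarnessLib
import HarnessLib.Audit
import Summits.Parity.Statement
import Literature.NumberTheory.Sieve.CubicMinorantDefs
import Literature.NumberTheory.Sieve.HeathBrownCubicPrimesHolds
import Literature.NumberTheory.Waring.HuaLemmaCubes
import HarnessLib.Audit.Status.Attr

/-!
Route: VinogradovHeathBrown

CLOSED (proved) 2026-08-26T18:14:17Z by planner-parity-ideate-p2-g5-0 — reason: proved:Summit.Parity.GeneralizedHardyLittlewood.Theses.VinogradovHeathBrown.vinogradovHeathBrown_holds — note: PROVED close (route pen p2, per TURNKEY §after; ref g23 verdict 17:18/17:21Z): target stmt-Parity-19774 = the D-0061 rung leaf F-P1 (operator-registered), proved by vinogradovHeathBrown_holds (p457391, commit 8fad0800046d, axioms std) := closes mainTermLower_holds errorTermBound_holds readout_holds . The file is kept as the record of this route; refuted decls are indexed as negative knowledge (`ledger negatives`).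

# Route VinogradovHeathBrown — every large odd N is p + q + π with π = x³+2y³ a Heath-Brown prime
exceeding N/2

X = the five analytic blocks of Vinogradov's three-primes circle method at scale N with the third
variable running over
Heath-Brown primes π = x³+2y³ ∈ (N/2, N] (weight `CubicMinorant.hbWeight c N`): X = MainTermLower ∧
ErrorTermBound ∧ Readout ∧
RoughModelFourierApprox ∧ HBFourierFourthMoment. It suffices to show X: with A = 8c + C₄⁺ + 8 the
main term c_M η² N² beats the
error C'N²(log N)^(−2c−1/4) plus the no-representation read-out C''N^(3/2)(log N)⁴, so every large
odd N is p + q + π — the rung leaf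
`VinogradovHeathBrown` (D-0061 rung F-P1 of Parity, cell parity-ideate seat p2, Line E). All five
blocks and the deciding theorem are
KERNEL-PROVED in cell evidence
`pub/parity-ideate/parity-ideate-p2/evidence/VinogradovHeathBrown.lean` (5193 lines, farm rc 0, 0
sorries,
standard axioms; lit seat's pre-split port texts
pub/parity-ideate/parity-ideate-lit/port/LineERoughModel.lean + LineEVinogradovHeathBrown.lean);
this route is the PORT of that theorem into the tree and shares RoughModelFourierApprox /
HBFourierFourthMoment with the sibling route HeathBrownPrimeAP3.
Lean: `Summit.Parity.GeneralizedHardyLittlewood.Theses.VinogradovHeathBrown.MainTermLower ∧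
Summit.Parity.GeneralizedHardyLittlewood.Theses.VinogradovHeathBrown.ErrorTermBound ∧
Summit.Parity.GeneralizedHardyLittlewood.Theses.VinogradovHeathBrown.Readout ∧
Summit.Parity.GeneralizedHardyLittlewood.Theses.VinogradovHeathBrown.RoughModelFourierApprox ∧
Summit.Parity.GeneralizedHardyLittlewood.Theses.VinogradovHeathBrown.HBFourierFourthMoment`

## Assembly
Pure bookkeeping (KERNEL-PROVED as `target_of_parts` in the evidence and re-certified here as
`closes`): fix c, κ from Heath-Brown's asymptotic
(tree theorem `CubicPrimes.HeathBrown2001_primePairCount_asymptotic_holds`), take C₄, c₁ from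
HBFourierFourthMoment, A = 8c + max C₄ 0 + 8 and B
from RoughModelFourierApprox; then MainTermLower − ErrorTermBound contradicts Readout for odd N ≥
N₁+N₃+N₄+N₅ because (1−A)/4 + 3/2 + C₄⁺/4 =
−2c − 1/4, (log N)^(−2c) ≤ η² and N^(3/2)(log N)^(4+2c) = o(N²).

CLOSES_TARGET: closes rung F-P1 of Parity: Summit.Parity.GeneralizedHardyLittlewood.Theses.VinogradovHeathBrown.VinogradovHeathBrown (D-0061; not the summit Statement) — the deciding theorem of this route concludes that registered leaf instead of the Statement decl `GeneralizedHardyLittlewood` (class rung: servable and labelled, never counted as concluding the summit Statement).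

Rationale: WHY THIS LINE. Mechanism: Green's transference principle run as an explicit weighted ternary count
T_N(Λ, Λ, f₃) = Σ_(n₁+n₂+n₃=N) Λ(n₁)Λ(n₂)f₃(n₃)
with f₃ the Heath-Brown representation weight (HeathBrownActa2001: ≫ η²X²/log X primes x³+2y³ ≤ 3X³,
a set of N^(2/3−o(1)) elements,
too thin for density transference or for exceptional-set pigeonhole, MontgomeryVaughan1975), Λ
replaced by the W-rough model g_B
(RoughModelFourierApprox: Siegel–Walfisz + Vaughan's identity, Vaughan1997 ch. 3) at a cost
controlled by the Hölder counting lemma with the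
fourth moment of f̂₃, itself bounded through the cubic Weyl sum by Hua's lemma with logarithmic loss
(tree: huaEighthMomentLog_holds,
Vaughan1986Cubes Thm 2). Imported areas: additive combinatorics (restriction for L⁴-controlled thin
sets, GreenTao2006Restriction, Green2005)
and the classical circle method (Vinogradov1937, Nathanson1996 ch. 8, Helfgott2013TernaryGoldbach).
No prior route of the sub places
polynomial prime values in an additive pattern; the negatives index (4 entries) is disjoint.

RANKED CRUXES. #0 VinogradovHeathBrown (target) — the rung leaf itself, as this route's target item
(D-0061 option (i), precedent route-Parity-FordMaynardNoSieveConst0164): there is N₀ such that every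
odd N ≥ N₀ is N = p + q + (x³+2y³) with p, q, x³+2y³ prime, x, y ≥ 1, and the Heath-Brown prime
exceeding N/2 — byte-identical body to the refereed leaf text
`pub/parity-ideate/parity-ideate-p2/leaves/VinogradovHeathBrownStatement.v2.lean` (= `rfl` to the
operator leaf `Summit.Parity.GeneralizedHardyLittlewood.VinogradovHeathBrown` if/when that is
landed); to be registered as the rung's ALT-CLOSER, after which `route edit --closes-target` serves
the route. KERNEL-PROVED in cell evidence (`ParityIdeateP2.LineE.vinogradovHeathBrown_holds`,
evidence/VinogradovHeathBrown.lean and evidence/LineEFG_tree.lean, rc 0, axioms std). (why it might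
fail: it cannot mathematically (kernel-proved in the cell evidence from the five blocks below); the
port can only bounce on a namespace/normalisation drift between the landed CubicMinorantDefs and the
evidence.) [HeathBrownActa2001, Vinogradov1937, Vaughan1997]
#2 ErrorTermBound (crux) — |T(Λ,Λ,f₃) − T(g_B,g_B,f₃)| ≤ C'N²(log N)^((1−A)/4+3/2+C₄/4) given E2's
sup bound with exponent A and the fourth-moment bound with exponent C₄ (block E3b of the evidence;
E5 Hölder counting lemma). [difficulty: M] (why it might fail: PROVED in cell evidence
(errorTermBound_holds); as a port it fails only if the tree's Hua normalisation (cubicWeylSum over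
[1,P], log-power C) mismatches the evidence's E4b bridge hbFourthMomentReduction — then ≈300 lines
of re-bridging.) [Vaughan1997, GreenTao2006Restriction, Vaughan1986Cubes]
#3 MainTermLower (crux) — the rough-model main term: T(g_B, g_B, f₃) ≥ c_M η² N² for odd N ≥ N₀,
from the rough-pair lower bound Σ_(n₁+n₂=m) g g ≥ c₀ m for the even numbers m = N − π < N/2 (N odd,
π odd) in the range where the rough model has full mass, and Heath-Brown's count of π ∈ (N/2, N]
(block E3a; HB's lower bound is the displayed hypothesis). [difficulty: M] (why it might fail:
PROVED in cell evidence (mainTermLower_holds); port risk only: the singular-series-free lower bound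
uses N odd ⇒ N − π even and the primorial level W = W(B,N) of the defs leaf verbatim.)
[HeathBrownActa2001, Nathanson1996, Vinogradov1937]
#4 Readout (crux) — if odd N has no representation p + q + π with π ∈ (N/2, N] a Heath-Brown prime
then T(Λ,Λ,f₃) ≤ C''N^(3/2)(log N)⁴: only prime-power terms survive (block E3c). [difficulty: S]
(why it might fail: PROVED in cell evidence (readout_holds); port risk only: Chebyshev bounds for
prime powers (Mathlib.NumberTheory.Chebyshev) and hbRep ≤ #pairs used verbatim.)
[HeathBrownActa2001, Nathanson1996]
#9 RoughModelFourierApprox (support) — E2 (shared with route HeathBrownPrimeAP3): for every A > 0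
there is B > 0 with sup_α |Λ̂_N(α) − ĝ_(B,N)(α)| ≤ C N (log N)^(−A), g the W-rough model of level
(log N)^B (PROVED in evidence, 1805-line block; lit port text port/LineERoughModel.lean).
[difficulty: L] [Vaughan1997, IwaniecKowalski2004, Green2005]
#9 HBFourierFourthMoment (support) — E4 (shared): ∫₀¹ |Σ_π hbWeight(π) e(πα)|⁴ dα ≤ c₁ N³ (log N)^C
— from Hua's eighth-moment lemma with logarithmic loss (tree theorem huaEighthMomentLog_holds,
p406333) via the PROVED reduction hbFourthMomentReduction. [difficulty: M] [Vaughan1986Cubes,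
Vaughan1997, HeathBrownActa2001]

TWO-LAYER PLAN. ErrorTermBound ⇐ HolderCounting (E5) → ErrorTermBound; MainTermLower ⇐
RoughModelPairCountLower (E6: Σ_(n₁+n₂=m) g g ≥ c₀ m for even m) → MassLower
(Σ_π f₃(π) ≥ (κ/16) η² N) → MainTermLower. Both exist as theorems in the evidence
(holderCounting_holds, ternarySum_ge_fibre, mass_le/mass lower
bound); filed only if a porting prover asks.

KILL CRITERIA. Nothing mathematical can kill the line: target and all five blocks are kernel-checked
(evidence + check.json). The route is MOOTED (close
--reason superseded) if the operator/lit seat ports the evidence file directly into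
Summits/Parity/GeneralizedHardyLittlewood/Theorems/ (then
`theorem … : VinogradovHeathBrown` closes the target without items); it stays DRAFT
(glue.conclusion-mismatch by design, D-0061 option (i)) until the
target item
`Summit.Parity.GeneralizedHardyLittlewood.Theses.VinogradovHeathBrown.VinogradovHeathBrown` is
registered as the F-P1 rung ALT-CLOSER (then
`ledger route edit <id> --closes-target <that FQN> --closes-file glue.lean`; if the operator lands
an independent leaf instead, the same edit with that
leaf — bodies are `rfl`-equal); if registration is refused the items still serve the sibling
port-route HeathBrownPrimeAP3.

NOT DECOMPOSED YET. The 1805-line E2 block and the E5/E6 lemmas are not itemised (support-level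
ports with verbatim texts); constants are fixed by the evidence.

CHEAPEST FALSIFIER. Already run: farm lean check of the evidence rc 0 (0 sorries, standard axioms)
and `ledger route check --native route.json --closes-file glue.lean`
(2026-08-25, g4): every item and `closes` elaborate against the landed CubicMinorantDefs (p407241) —
a namespace/normalisation mismatch there is the
one thing that can bounce the port; only the by-design pre-flight conclusion-mismatch remains until
the ALT-CLOSER registration.

DEFINITION REQUESTS. Operator landing WANTED (planners cannot propose; texts farm-checked rc 0,
published at pub/parity-ideate/parity-ideate-p2/leaves/): (D1) DONE — the
defs leaf LANDED as Literature/NumberTheory/Sieve/CubicMinorantDefs.lean (lit seat p407241, commit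
ac6922f92647, namespace
Literature.NumberTheory.Sieve.CubicMinorant), over which every item above is typed; (D3) NO LEAF
NEEDED under D-0061 option (i): the target item of
this route (`…Theses.VinogradovHeathBrown.VinogradovHeathBrown`, body =
leaves/VinogradovHeathBrownStatement.v2.lean verbatim) is the rung leaf; WANTED =
its ALT-CLOSER registration (sub Parity/GeneralizedHardyLittlewood, class rung, rung F-P1); idem
(D2) for the sibling route HeathBrownPrimeAP3. No
Literature notion is missing; cite facts: none (Hua landed as p406333, Heath-Brown and Vinogradov
are tree theorems/facts).

Novelty: Label of record (tribunal J 2026-08-26T08:56:37Z, tier A, ledger FRONTIER): «Vinogradov three primes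
with one Heath-Brown prime π = x³+2y³ > N/2 — new additive theorem for an N^{2/3−o(1)}-sparse
special set with no density / distribution hypothesis; ternary-shaped weighted circle method + Hua
L⁴ restriction; log savings; ineffective N₀; FRONTIER; no bearing on prime pairs / parity / GHL».
Searches (2026-08-24/25, Line E pass + LIT-PACK §2.13 of the lit seat): lit search "three primes
theorem one prime special form thin set" / "Vinogradov three primes one prime from sparse set"; lit
frontier Parity --since 2020; lit bridges Parity --cross any; lit galaxy search
"x^3+2y^3|Heath-Brown primes|ternary Goldbach thin" --star all (0 research hits beyond holdings);
lit search "Goldbach numbers sparse sequences polynomial values" (BrudernPerelli1998,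
BrudernKawadaWooley2000).
Nearest prior art found: Balog–Friedlander 1992 (ternary Goldbach with Piatetski-Shapiro primes,
density N^(1/γ)), MatomakiShao2017 (Vinogradov's theorem with almost-equal / special primes via
transference, positive relative density), GrimmeltMerikoski2025 (primes p with p = a²+b⁴-type
restrictions in additive problems, needing Siegel–Walfisz-type equidistribution of the special set),
arXiv:1611.08585 (Teräväinen 2018: Goldbach-type problems for primes x²+y²+1, relative density > 0).
Delta: the special summand ranges over the N^(−1/3)-SPARSE Heath-Brown set {x³+2y³ prime}, for which
neither relative density nor eq  [refs: 10.2140/pjm.1992.156.45, 1611.08585, doi:10.2140/pjm.1992.156.45, paper:doi-10-4064-aa-73-1-1-28, BrudernPerelli1998, BrudernKawadaWooley2000, MatomakiShao2017, GrimmeltMerikoski2025]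

Barriers (technique_class: circle-method, weighted-restriction, thin-third-variable): - technique_class: circle-method, weighted-restriction, thin-third-variable
- Literature.Barriers.Parity.CircleMethodBinaryBarrier: outside its class — the count is TERNARY in
the circle-method sense (two free prime variables p, q plus the weighted third variable π, linear
system (n₁, n₂, N − n₁ − n₂ = π) with three summands): the minor arcs are bounded by Hölder ∫|S|²|F|
≤ (sup|S| on 𝔪)^(1/2)(∫|S|²)^(3/4)(∫|F|⁴)^(1/4) where the thin weight's L⁴ norm
(HBFourierFourthMoment) supplies the saving — the barrier quantifies over BINARY correlations ∫ S W̄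
e(−hα) with one fixed shift, which this count is not.
- Literature.Barriers.Parity.RedactedPrimes: outside — the inputs are of three-primes strength
(Vinogradov/Vaughan sup bound x(log x)^(−A) on the minor arcs and Siegel–Walfisz major arcs at
precision x(log x)^(−B)), which the barrier's audit lists as OUTSIDE the loose-information class,
and the conclusion is a ternary count, not R(x) > 0 for a given even x.
- Literature.Barriers.Parity.GoldbachAverageZerosNarrow: not met — no power saving is claimed or
implied anywhere: all savings are powers of log N (error exponent −2c − 1/4 vs main −2c), and the
conclusion (odd N = p + q + π with a Heath-Brown prime π) implies no `PowerSavingGoldbachAverage δ`.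
- Literature.Barriers.Parity.GoldbachAverageZeros: idem — log-power savings only; the explicit
formula / zeros of L-functions never enter (Siegel–Walfisz at level (log N)^B is the only
distributional input, ineffective N₀ allowed sinc

History (route lifecycle, newest last):
- 2026-08-26T08:02:19Z · closes_target -> closes rung F-P1 of Parity: Summit.Parity.GeneralizedHardyLittlewood.Theses.VinogradovHeathBrown.VinogradovHeathBrown (D-0061; not the summit Statement) (operator:999:2956369)
- 2026-08-26T18:14:17Z · CLOSED proved — proved:Summit.Parity.GeneralizedHardyLittlewood.Theses.VinogradovHeathBrown.vinogradovHeathBrown_holds (planner-parity-ideate-p2-g5-0)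

sub-problem: GeneralizedHardyLittlewood · status: closed(proved) · opened planner-parity-ideate-p2-g4-0 2026-08-25T22:17:55Z · rev 3 · ledger route-Parity-VinogradovHeathBrown
GENERATED by the gate from the ledger (D-0016/17). Provers cite these decls: `theorem foo : Summit.Parity.GeneralizedHardyLittlewood.Theses.VinogradovHeathBrown.<Decl> := …` in Summits/Parity/GeneralizedHardyLittlewood/Theorems/<Name>.lean.
-/

namespace Summit.Parity.GeneralizedHardyLittlewood.Theses.VinogradovHeathBrown

open scoped BigOperators Topology Manifold Classical MeasureTheory ProbabilityTheory Matrix InnerProductSpace ComplexConjugate ContinuousMap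
open Filter Set Function TopologicalSpace MeasureTheory

attribute [summit_statement] _root_.GeneralizedHardyLittlewood
-- H21.Audit: the closer leaf Summit.Parity.GeneralizedHardyLittlewood.Theses.VinogradovHeathBrown.VinogradovHeathBrown is an item decl of this route file — tagged summit_statement below, after its declaration

/-- item stmt-Parity-19774 · target · rank 0 · closed · proved by Summit.Parity.GeneralizedHardyLittlewood.Theses.VinogradovHeathBrown.vinogradovHeathBrown_holds @ 8fad0800046d (reviewer) · by planner
why it might fail: it cannot mathematically (kernel-proved); vinogradovHeathBrown_holds := closes … is in port file 3/6 (farm rc 0 in the chained check); lands after files 1–2.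
sources: HeathBrownActa2001, Vinogradov1937, Vaughan1997
[target] the rung leaf itself, as this route's target item (D-0061 option (i), precedent
route-Parity-FordMaynardNoSieveConst0164): there is N₀ such that every odd N ≥ N₀ is N = p + q +
(x³+2y³) with p, q, x³+2y³ prime, x, y ≥ 1, and the Heath-Brown prime exceeding N/2 — byte-identical
body to the refereed leaf text
`pub/parity-ideate/parity-ideate-p2/leaves/VinogradovHeathBrownStatement.v2.lean` (= `rfl` to the
operator leaf `Summit.Parity.GeneralizedHardyLittlewood.VinogradovHeathBrown` if/when that is
landed); to be registered as the rung's ALT-CLOSER, after which `route edit --closes-target` serves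
the route. KERNEL-PROVED in cell evidence (`ParityIdeateP2.LineE.vinogradovHeathBrown_holds`,
evidence/VinogradovHeathBrown.lean and evidence/LineEFG_tree.lean, rc 0, axioms std). -/
@[route_item "route-Parity-VinogradovHeathBrown"]
def VinogradovHeathBrown : Prop :=
  ∃ N₀ : ℕ, ∀ N : ℕ, N₀ ≤ N → Odd N → ∃ p q x y : ℕ, 0 < x ∧ 0 < y ∧ p.Prime ∧ q.Prime ∧ (x ^ 3 + 2 * y ^ 3).Prime ∧ p + q + (x ^ 3 + 2 * y ^ 3) = N ∧ N < 2 * (x ^ 3 + 2 * y ^ 3)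

-- `VinogradovHeathBrown` holds: proved by `Summit.Parity.GeneralizedHardyLittlewood.Theses.VinogradovHeathBrown.vinogradovHeathBrown_holds` @ 8fad0800046d (its module imports this route file, so no `_holds` link can be stated here).

/-- item stmt-Parity-19775 · crux · rank 2 · closed · proved by Summit.Parity.GeneralizedHardyLittlewood.Theses.VinogradovHeathBrown.errorTermBound_holds (reviewer) · by planner
why it might fail: PROVED in cell evidence (errorTermBound_holds) and port-ready (VinogradovHeathBrownErrorTerm.lean, farm rc 0); Hua-normalisation risk discharged by the landed hbFourierFourthMoment_holds; residual risk = a gate dedup.landed bounce on a helper (mechanical rename).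
sources: Vaughan1997, GreenTao2006Restriction, Vaughan1986Cubes
[crux] |T(Λ,Λ,f₃) − T(g_B,g_B,f₃)| ≤ C'N²(log N)^((1−A)/4+3/2+C₄/4) given E2's sup bound with
exponent A and the fourth-moment bound with exponent C₄ (block E3b of the evidence; E5 Hölder
counting lemma). [difficulty: M] -/
@[route_item "route-Parity-VinogradovHeathBrown", crux]
def ErrorTermBound : Prop :=
  ∀ c : ℝ, 0 < c → ∀ C₄ c₁ : ℝ, (∀ N : ℕ, 3 ≤ N → ∫ α in (0 : ℝ)..1, ‖Literature.NumberTheory.Sieve.CubicMinorant.hbExpSum c N α‖ ^ 4 ≤ c₁ * (N : ℝ) ^ 3 * Real.log N ^ C₄) → ∀ A B C : ℝ, 0 < A → 0 < B → ∀ N₂ : ℕ, (∀ N : ℕ, N₂ ≤ N → ∀ α : ℝ, ‖Literature.NumberTheory.Sieve.primeExpSum N α - Literature.NumberTheory.Sieve.CubicMinorant.roughExpSum B N α‖ ≤ C * (N : ℝ) * Real.log N ^ (-A)) → ∃ C' : ℝ, ∃ N₀ : ℕ, ∀ N : ℕ, N₀ ≤ N → |Literature.NumberTheory.Sieve.CubicMinorant.ternarySum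 (Literature.NumberTheory.Sieve.CubicMinorant.vmWeight N) (Literature.NumberTheory.Sieve.CubicMinorant.vmWeight N) (Literature.NumberTheory.Sieve.CubicMinorant.hbWeight c N) N - Literature.NumberTheory.Sieve.CubicMinorant.ternarySum (Literature.NumberTheory.Sieve.CubicMinorant.gWeight B N) (Literature.NumberTheory.Sieve.CubicMinorant.gWeight B N) (Literature.NumberTheory.Sieve.CubicMinorant.hbWeight c N) N| ≤ C' * (N : ℝ) ^ 2 * Real.log N ^ ((1 - A) / 4 + 3 / 2 + C₄ / 4)

-- `ErrorTermBound` holds: proved by `Summit.Parity.GeneralizedHardyLittlewood.Theses.VinogradovHeathBrown.errorTermBound_holds` (its module imports this route file, so no `_holds` link can be stated here).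

/-- item stmt-Parity-19776 · crux · rank 3 · closed · proved by Summit.Parity.GeneralizedHardyLittlewood.Theses.VinogradovHeathBrown.mainTermLower_holds (reviewer) · by planner
why it might fail: PROVED in cell evidence (mainTermLower_holds) and port-ready (VinogradovHeathBrownMainTerm.lean, farm rc 0); residual risk = gate dedup/lint bounce only; N odd ⇒ N − π even and W = W(B,N) match the landed CubicMinorantDefs verbatim (checked by elaboration).
sources: HeathBrownActa2001, Nathanson1996, Vinogradov1937
[crux] the rough-model main term: T(g_B, g_B, f₃) ≥ c_M η² N² for odd N ≥ N₀, from the rough-pair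
lower bound Σ_(n₁+n₂=m) g g ≥ c₀ m for the even numbers m = N − π < N/2 (N odd, π odd) in the range
where the rough model has full mass, and Heath-Brown's count of π ∈ (N/2, N] (block E3a; HB's lower
bound is the displayed hypothesis). [difficulty: M] -/
@[route_item "route-Parity-VinogradovHeathBrown", crux]
def MainTermLower : Prop :=
  ∀ c : ℝ, 0 < c → ∀ κ : ℝ, 0 < κ → (∀ᶠ X : ℝ in atTop, κ * ((Real.log X ^ (-c)) ^ 2 * X ^ 2 / Real.log X) ≤ Literature.NumberTheory.Sieve.CubicPrimes.primePairCount X (Real.log X ^ (-c))) → ∀ B : ℝ, 0 < B → ∃ cM : ℝ, 0 < cM ∧ ∃ N₀ : ℕ, ∀ N : ℕ, N₀ ≤ N → Odd N → cM * Literature.NumberTheory.Sieve.CubicMinorant.hbEta c N ^ 2 * (N : ℝ) ^ 2 ≤ Literature.NumberTheory.Sieve.CubicMinorant.ternarySum (Literature.NumberTheory.Sieve.CubicMinorant.gWeight B N) (Literature.NumberTheory.Sieve.CubicMinorant.gWeight B N) (Literature.NumberTheory.Sieve.CubicMinorant.hbWeight c N) N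

-- `MainTermLower` holds: proved by `Summit.Parity.GeneralizedHardyLittlewood.Theses.VinogradovHeathBrown.mainTermLower_holds` (its module imports this route file, so no `_holds` link can be stated here).

/-- item stmt-Parity-19777 · crux · rank 4 · closed · proved by Summit.Parity.GeneralizedHardyLittlewood.Theses.VinogradovHeathBrown.readout_holds (reviewer) · by planner
why it might fail: PROVED in cell evidence (readout_holds) and port-ready (VinogradovHeathBrownReadout.lean: farm rc 0 ALONE against the tree, gate preflight verdict accept); residual risk = none known beyond reload windows.
sources: HeathBrownActa2001, Nathanson1996
[crux] if odd N has no representation p + q + π with π ∈ (N/2, N] a Heath-Brown prime then T(Λ,Λ,f₃)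
≤ C''N^(3/2)(log N)⁴: only prime-power terms survive (block E3c). [difficulty: S] -/
@[route_item "route-Parity-VinogradovHeathBrown", crux]
def Readout : Prop :=
  ∀ c : ℝ, 0 < c → ∃ C'' : ℝ, ∃ N₀ : ℕ, ∀ N : ℕ, N₀ ≤ N → Odd N → (¬ ∃ p q x y : ℕ, 0 < x ∧ 0 < y ∧ p.Prime ∧ q.Prime ∧ (x ^ 3 + 2 * y ^ 3).Prime ∧ p + q + (x ^ 3 + 2 * y ^ 3) = N ∧ N < 2 * (x ^ 3 + 2 * y ^ 3)) → Literature.NumberTheory.Sieve.CubicMinorant.ternarySum (Literature.NumberTheory.Sieve.CubicMinorant.vmWeight N) (Literature.NumberTheory.Sieve.CubicMinorant.vmWeight N) (Literature.NumberTheory.Sieve.CubicMinorant.hbWeight c N) N ≤ C'' * (N : ℝ) ^ ((3 : ℝ) / 2) * Real.log N ^ (4 : ℝ)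

-- `Readout` holds: proved by `Summit.Parity.GeneralizedHardyLittlewood.Theses.VinogradovHeathBrown.readout_holds` (its module imports this route file, so no `_holds` link can be stated here).

/-- item stmt-Parity-19666 · support · rank 9 · open · by planner
sources: Vaughan1997, IwaniecKowalski2004, Green2005
[support] E2 of Line E (shared with route VinogradovHeathBrown): for every A > 0 there is B > 0 with
sup_α |Λ̂_N(α) − ĝ_(B,N)(α)| ≤ C N (log N)^(−A), g the W-rough model of level (log N)^B
(Siegel–Walfisz on major arcs, Vaughan/Vinogradov on minor arcs; PROVED in evidence, 1805-line
block, lit port text port/LineERoughModel.lean). [difficulty: L] -/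
@[route_item "route-Parity-VinogradovHeathBrown", crux]
def RoughModelFourierApprox : Prop :=
  ∀ A : ℝ, 0 < A → ∃ B : ℝ, 0 < B ∧ ∃ C : ℝ, ∃ N₀ : ℕ, ∀ N : ℕ, N₀ ≤ N → ∀ α : ℝ, ‖Literature.NumberTheory.Sieve.primeExpSum N α - Literature.NumberTheory.Sieve.CubicMinorant.roughExpSum B N α‖ ≤ C * (N : ℝ) * Real.log N ^ (-A)

/-- item stmt-Parity-19667 · support · rank 9 · open · by planner
sources: Vaughan1986Cubes, Vaughan1997, HeathBrownActa2001
[support] E4 of Line E (shared): ∫₀¹ |Σ_π hbWeight(π) e(πα)|⁴ dα ≤ c₁ N³ (log N)^C — from Hua's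
eighth-moment lemma with logarithmic loss (tree theorem huaEighthMomentLog_holds, p406333) via the
PROVED reduction hbFourthMomentReduction (Cauchy–Schwarz in y, sixteen-fold cubic equation count).
[difficulty: M] -/
@[route_item "route-Parity-VinogradovHeathBrown", crux]
def HBFourierFourthMoment : Prop :=
  ∀ c : ℝ, 0 < c → ∃ C c₁ : ℝ, ∀ N : ℕ, 3 ≤ N → ∫ α in (0 : ℝ)..1, ‖Literature.NumberTheory.Sieve.CubicMinorant.hbExpSum c N α‖ ^ 4 ≤ c₁ * (N : ℝ) ^ 3 * Real.log N ^ C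

/-- item stmt-Parity-19778 · assembly · rank 1 · closed · moot by None · by planner
sources: HeathBrownActa2001, Vinogradov1937
[assembly] MainTermLower → ErrorTermBound → Readout → RoughModelFourierApprox →
HBFourierFourthMoment → VinogradovHeathBrown (the target item = the rung leaf). The deciding theorem
`closes` (glue.lean) PROVES this item inline (`have hA : Assembly := …` = the evidence theorem
`target_of_parts` with Heath-Brown's lower bound derived from the tree) and applies it, so every
declared item is in the cone of `closes` (BC6). Until the target is registered as ALT-CLOSER the
gate reads the conclusion as glue.conclusion-mismatch and the route is DRAFT by design. -/
@[route_item "route-Parity-VinogradovHeathBrown"]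
def Assembly : Prop :=
  MainTermLower → ErrorTermBound → Readout → RoughModelFourierApprox → HBFourierFourthMoment → VinogradovHeathBrown

attribute [summit_statement] _root_.Summit.Parity.GeneralizedHardyLittlewood.Theses.VinogradovHeathBrown.VinogradovHeathBrown

/-! D-0027 §2.1 — DECIDING THEOREM (planner-authored via `route open/edit --closes-file`; by operator:999:2956369 2026-08-26T08:02:19Z) — ARCHIVED: route closed (proved) 2026-08-26T18:14:17Z; kept so importers keep building:
its hypotheses are this route's items and its conclusion the registered leaf `Summit.Parity.GeneralizedHardyLittlewood.Theses.VinogradovHeathBrown.VinogradovHeathBrown` (rung F-P1, D-0061) (glue_lint), and it elaborates with this file. -/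

/-! D-0027 §2.1 deciding theorem of the port route: the five blocks imply the target item (= the rung leaf, D-0061 option (i)). Adapted verbatim from the
cell evidence theorem `target_of_parts` (KERNEL-PROVED there together with all five hypotheses), with Heath-Brown's
lower bound `π(𝒜)(X,(log X)^{-c}) ≥ κ η² X²/log X` (A0) derived inline from the tree theorem
`CubicPrimes.HeathBrown2001_primePairCount_asymptotic_holds`. -/

@[closes "route-Parity-VinogradovHeathBrown"] theorem closes (h₁ : MainTermLower) (h₂ : ErrorTermBound) (h₃ : Readout)
    (hE2 : RoughModelFourierApprox) (hE4b : HBFourierFourthMoment) :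
    VinogradovHeathBrown := by
  -- the Assembly item IS the composition; prove it (the cell evidence theorem `target_of_parts`, with
  -- Heath-Brown's lower bound A0 derived from the tree), then apply it — keeps `Assembly` in the cone of `closes` (BC6)
  have hA : Assembly := by
    intro h₁ h₂ h₃ hE2 hE4b
    show ∃ N₀ : ℕ, ∀ N : ℕ, N₀ ≤ N → Odd N → ∃ p q x y : ℕ, 0 < x ∧ 0 < y ∧ p.Prime ∧ q.Prime ∧ (x ^ 3 + 2 * y ^ 3).Prime ∧
      p + q + (x ^ 3 + 2 * y ^ 3) = N ∧ N < 2 * (x ^ 3 + 2 * y ^ 3)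
    have hA0 : ∃ c : ℝ, 0 < c ∧ ∃ κ : ℝ, 0 < κ ∧ ∀ᶠ X : ℝ in atTop,
        κ * ((Real.log X ^ (-c)) ^ 2 * X ^ 2 / Real.log X) ≤
          Literature.NumberTheory.Sieve.CubicPrimes.primePairCount X (Real.log X ^ (-c)) := by
      obtain ⟨c, hc, σ₀, hσ₀, -, hO⟩ :=
        Literature.NumberTheory.Sieve.CubicPrimes.HeathBrown2001_primePairCount_asymptotic_holds
      refine ⟨c, hc, σ₀ / 6, by positivity, ?_⟩
      obtain ⟨C, hC⟩ := hO.bound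
      have hg : Tendsto (fun X : ℝ => Real.log (Real.log X) ^ (-(1 / 6 : ℝ))) atTop (𝓝 0) :=
        (tendsto_rpow_neg_atTop (by norm_num : (0 : ℝ) < 1 / 6)).comp
          (Real.tendsto_log_atTop.comp Real.tendsto_log_atTop)
      have h1 : ∀ᶠ X : ℝ in atTop, |C| * |Real.log (Real.log X) ^ (-(1 / 6 : ℝ))| < 1 / 2 := by
        have h' := hg.abs.const_mul |C|
        rw [abs_zero, mul_zero] at h'
        exact h'.eventually (gt_mem_nhds (by norm_num))
      filter_upwards [hC, h1, eventually_gt_atTop (1 : ℝ)] with X hCX h1X hX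
      have hM : 0 < Literature.NumberTheory.Sieve.CubicPrimes.mainTerm c σ₀ X := Literature.NumberTheory.Sieve.CubicPrimes.mainTerm_pos hσ₀ hX
      have hlt : |(Literature.NumberTheory.Sieve.CubicPrimes.primePairCount X (Real.log X ^ (-c)) : ℝ) - Literature.NumberTheory.Sieve.CubicPrimes.mainTerm c σ₀ X| ≤
          Literature.NumberTheory.Sieve.CubicPrimes.mainTerm c σ₀ X * (1 / 2) := by
        calc |(Literature.NumberTheory.Sieve.CubicPrimes.primePairCount X (Real.log X ^ (-c)) : ℝ) - Literature.NumberTheory.Sieve.CubicPrimes.mainTerm c σ₀ X|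
            ≤ C * ‖Literature.NumberTheory.Sieve.CubicPrimes.mainTerm c σ₀ X * Real.log (Real.log X) ^ (-(1 / 6 : ℝ))‖ := by
              simpa only [Real.norm_eq_abs] using hCX
          _ ≤ |C| * ‖Literature.NumberTheory.Sieve.CubicPrimes.mainTerm c σ₀ X * Real.log (Real.log X) ^ (-(1 / 6 : ℝ))‖ :=
              mul_le_mul_of_nonneg_right (le_abs_self C) (norm_nonneg _)
          _ = Literature.NumberTheory.Sieve.CubicPrimes.mainTerm c σ₀ X * (|C| * |Real.log (Real.log X) ^ (-(1 / 6 : ℝ))|) := by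
              rw [Real.norm_eq_abs, abs_mul, abs_of_pos hM]; ring
          _ ≤ Literature.NumberTheory.Sieve.CubicPrimes.mainTerm c σ₀ X * (1 / 2) := mul_le_mul_of_nonneg_left h1X.le hM.le
      have h2 := (abs_sub_le_iff.1 hlt).2
      calc σ₀ / 6 * ((Real.log X ^ (-c)) ^ 2 * X ^ 2 / Real.log X)
          = Literature.NumberTheory.Sieve.CubicPrimes.mainTerm c σ₀ X - Literature.NumberTheory.Sieve.CubicPrimes.mainTerm c σ₀ X * (1 / 2) := by rw [Literature.NumberTheory.Sieve.CubicPrimes.mainTerm_def]; ring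
        _ ≤ _ := by linarith
    obtain ⟨c, hc, κ, hκ, hHB⟩ := hA0
    obtain ⟨C₄, c₁, h4⟩ := hE4b c hc
    -- raise the constants of E4b to non-negative ones
    have hC₄' : 0 ≤ max C₄ 0 := le_max_right _ _
    have h4' : ∀ N : ℕ, 3 ≤ N →
        ∫ α in (0 : ℝ)..1, ‖Literature.NumberTheory.Sieve.CubicMinorant.hbExpSum c N α‖ ^ 4 ≤ max c₁ 0 * (N : ℝ) ^ 3 * Real.log N ^ max C₄ 0 := by
      intro N hN
      have h3 : (3 : ℝ) ≤ N := by exact_mod_cast hN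
      have hNpos : (0 : ℝ) < N := by linarith
      have hL1 : 1 ≤ Real.log N := by
        rw [Real.le_log_iff_exp_le hNpos]
        have := Real.exp_one_lt_d9
        linarith
      have hL0 : 0 < Real.log N := by linarith
      refine (h4 N hN).trans ?_
      calc c₁ * (N : ℝ) ^ 3 * Real.log N ^ C₄ ≤ max c₁ 0 * (N : ℝ) ^ 3 * Real.log N ^ C₄ :=
            mul_le_mul_of_nonneg_right (mul_le_mul_of_nonneg_right (le_max_left _ _) (by positivity))
              (Real.rpow_nonneg hL0.le _)
        _ ≤ max c₁ 0 * (N : ℝ) ^ 3 * Real.log N ^ max C₄ 0 :=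
            mul_le_mul_of_nonneg_left (Real.rpow_le_rpow_of_exponent_le hL1 (le_max_left _ _))
              (by positivity)
    -- the choice of `A`
    have hApos : 0 < 8 * c + max C₄ 0 + 8 := by positivity
    obtain ⟨B, hB, C, N₂, h2⟩ := hE2 (8 * c + max C₄ 0 + 8) hApos
    obtain ⟨cM, hcM, N₁, h1⟩ := h₁ c hc κ hκ hHB B hB
    obtain ⟨C', N₃, h3⟩ :=
      h₂ c hc (max C₄ 0) (max c₁ 0) h4' (8 * c + max C₄ 0 + 8) B C hApos hB N₂ h2
    obtain ⟨C'', N₄, h5⟩ := h₃ c hc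
    have hexp : (1 - (8 * c + max C₄ 0 + 8)) / 4 + 3 / 2 + max C₄ 0 / 4 =
        -(2 * c) + -(1 / 4 : ℝ) := by ring
    -- (i) `C' (log N)^{-1/4} ≤ c_M / 3` eventually
    have hev1 : ∀ᶠ N : ℕ in atTop, C' * Real.log N ^ (-(1 / 4 : ℝ)) ≤ cM / 3 := by
      have hg : Tendsto (fun N : ℕ => C' * Real.log N ^ (-(1 / 4 : ℝ))) atTop (𝓝 (C' * 0)) :=
        ((tendsto_rpow_neg_atTop (by norm_num : (0 : ℝ) < 1 / 4)).comp
          (Real.tendsto_log_atTop.comp tendsto_natCast_atTop_atTop)).const_mul C'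
      rw [mul_zero] at hg
      exact (hg.eventually (gt_mem_nhds (by positivity : (0 : ℝ) < cM / 3))).mono fun N h => h.le
    -- (ii) `|C''| (log N)^{4 + 2c} ≤ (c_M/3) N^{1/2}` eventually
    have hev2 : ∀ᶠ N : ℕ in atTop,
        |C''| * Real.log N ^ (4 + 2 * c) ≤ cM / 3 * (N : ℝ) ^ ((1 : ℝ) / 2) := by
      have ho := (isLittleO_log_rpow_rpow_atTop (4 + 2 * c) (by norm_num : (0 : ℝ) < 1 / 2)).def
        (show (0 : ℝ) < cM / 3 / (|C''| + 1) by positivity)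
      filter_upwards [tendsto_natCast_atTop_atTop.eventually ho] with N hN
      have hL0 : 0 ≤ Real.log N := Real.log_natCast_nonneg N
      rw [Real.norm_of_nonneg (Real.rpow_nonneg hL0 _),
        Real.norm_of_nonneg (Real.rpow_nonneg (Nat.cast_nonneg N) _)] at hN
      have hC0 : 0 ≤ |C''| := abs_nonneg _
      have hfrac : |C''| * (cM / 3 / (|C''| + 1)) ≤ cM / 3 := by
        rw [mul_div_assoc', div_le_iff₀ (by positivity)]
        nlinarith
      calc |C''| * Real.log N ^ (4 + 2 * c)
          ≤ |C''| * (cM / 3 / (|C''| + 1) * (N : ℝ) ^ ((1 : ℝ) / 2)) :=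
            mul_le_mul_of_nonneg_left hN hC0
        _ = |C''| * (cM / 3 / (|C''| + 1)) * (N : ℝ) ^ ((1 : ℝ) / 2) := by ring
        _ ≤ cM / 3 * (N : ℝ) ^ ((1 : ℝ) / 2) := mul_le_mul_of_nonneg_right hfrac (by positivity)
    -- (iii) `(log N)^{-2c} ≤ η²` for `N > 6`
    have hev3 : ∀ᶠ N : ℕ in atTop, Real.log N ^ (-(2 * c)) ≤ Literature.NumberTheory.Sieve.CubicMinorant.hbEta c N ^ 2 := by
      filter_upwards [eventually_gt_atTop 6] with N hN
      -- inlined `hbX_facts` / `log_rpow_neg_le_hbEta_sq` of the cell evidence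
      have hN6 : (6 : ℝ) < N := by exact_mod_cast hN
      have hdiv : (1 : ℝ) < (N : ℝ) / 6 := by rw [lt_div_iff₀ (by norm_num)]; linarith
      have hX1 : 1 < Literature.NumberTheory.Sieve.CubicMinorant.hbX N := Real.one_lt_rpow hdiv (by norm_num)
      have hLX : 0 < Real.log (Literature.NumberTheory.Sieve.CubicMinorant.hbX N) := Real.log_pos hX1
      have hLXle : Real.log (Literature.NumberTheory.Sieve.CubicMinorant.hbX N) ≤ Real.log N := by
        unfold Literature.NumberTheory.Sieve.CubicMinorant.hbX
        rw [Real.log_rpow (by positivity)]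
        have h1 : Real.log ((N : ℝ) / 6) ≤ Real.log N :=
          Real.log_le_log (by positivity) (by linarith)
        have h2 : 0 ≤ Real.log ((N : ℝ) / 6) := Real.log_nonneg hdiv.le
        linarith
      have hsq : Literature.NumberTheory.Sieve.CubicMinorant.hbEta c N ^ 2 = Real.log (Literature.NumberTheory.Sieve.CubicMinorant.hbX N) ^ (-(2 * c)) := by
        unfold Literature.NumberTheory.Sieve.CubicMinorant.hbEta
        rw [← Real.rpow_natCast, ← Real.rpow_mul hLX.le]
        congr 1; push_cast; ring
      rw [hsq]
      exact Real.rpow_le_rpow_of_nonpos hLX hLXle (by linarith)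
    obtain ⟨N₅, hN₅⟩ := Filter.eventually_atTop.1
      (hev1.and (hev2.and (hev3.and (eventually_gt_atTop 6))))
    refine ⟨N₁ + N₃ + N₄ + N₅, fun N hN hodd => ?_⟩
    obtain ⟨hi, hii, hiii, hN6⟩ := hN₅ N (by omega)
    by_contra hno
    have hT := h5 N (by omega) hodd hno
    have hM := h1 N (by omega) hodd
    have hE := h3 N (by omega)
    rw [hexp] at hE
    have hE' := (abs_sub_le_iff.1 hE).2
    have hNpos : (0 : ℝ) < N := by exact_mod_cast (show 0 < N by omega)
    have hL0 : 0 < Real.log N := Real.log_pos (by exact_mod_cast (show 1 < N by omega))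
    have hQpos : 0 < (N : ℝ) ^ 2 * Real.log N ^ (-(2 * c)) := by positivity
    -- (a) `c_M N² (log N)^{-2c} ≤ T(g, g, f₃)`
    have ha : cM * ((N : ℝ) ^ 2 * Real.log N ^ (-(2 * c))) ≤
        Literature.NumberTheory.Sieve.CubicMinorant.ternarySum (Literature.NumberTheory.Sieve.CubicMinorant.gWeight B N) (Literature.NumberTheory.Sieve.CubicMinorant.gWeight B N) (Literature.NumberTheory.Sieve.CubicMinorant.hbWeight c N) N := by
      refine le_trans ?_ hM
      calc cM * ((N : ℝ) ^ 2 * Real.log N ^ (-(2 * c)))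
          = cM * Real.log N ^ (-(2 * c)) * (N : ℝ) ^ 2 := by ring
        _ ≤ cM * Literature.NumberTheory.Sieve.CubicMinorant.hbEta c N ^ 2 * (N : ℝ) ^ 2 :=
            mul_le_mul_of_nonneg_right (mul_le_mul_of_nonneg_left hiii hcM.le) (by positivity)
    -- (b) the E2/E5/E4 error is `≤ (c_M/3) N² (log N)^{-2c}`
    have hb : C' * (N : ℝ) ^ 2 * Real.log N ^ (-(2 * c) + -(1 / 4 : ℝ)) ≤
        cM / 3 * ((N : ℝ) ^ 2 * Real.log N ^ (-(2 * c))) := by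
      rw [Real.rpow_add hL0]
      calc C' * (N : ℝ) ^ 2 * (Real.log N ^ (-(2 * c)) * Real.log N ^ (-(1 / 4 : ℝ)))
          = C' * Real.log N ^ (-(1 / 4 : ℝ)) * ((N : ℝ) ^ 2 * Real.log N ^ (-(2 * c))) := by ring
        _ ≤ cM / 3 * ((N : ℝ) ^ 2 * Real.log N ^ (-(2 * c))) :=
            mul_le_mul_of_nonneg_right hi hQpos.le
    -- (c) the prime-power junk is `≤ (c_M/3) N² (log N)^{-2c}`
    have hc' : C'' * (N : ℝ) ^ ((3 : ℝ) / 2) * Real.log N ^ (4 : ℝ) ≤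
        cM / 3 * ((N : ℝ) ^ 2 * Real.log N ^ (-(2 * c))) := by
      have hsplitL : Real.log N ^ (4 : ℝ) = Real.log N ^ (4 + 2 * c) * Real.log N ^ (-(2 * c)) := by
        rw [← Real.rpow_add hL0]; congr 1; ring
      have hsplitN : (N : ℝ) ^ 2 = (N : ℝ) ^ ((1 : ℝ) / 2) * (N : ℝ) ^ ((3 : ℝ) / 2) := by
        rw [← Real.rpow_add hNpos, ← Real.rpow_natCast]; congr 1; norm_num
      calc C'' * (N : ℝ) ^ ((3 : ℝ) / 2) * Real.log N ^ (4 : ℝ)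
          ≤ |C''| * (N : ℝ) ^ ((3 : ℝ) / 2) * Real.log N ^ (4 : ℝ) :=
            mul_le_mul_of_nonneg_right (mul_le_mul_of_nonneg_right (le_abs_self _) (by positivity))
              (by positivity)
        _ = |C''| * Real.log N ^ (4 + 2 * c) *
              ((N : ℝ) ^ ((3 : ℝ) / 2) * Real.log N ^ (-(2 * c))) := by rw [hsplitL]; ring
        _ ≤ cM / 3 * (N : ℝ) ^ ((1 : ℝ) / 2) *
              ((N : ℝ) ^ ((3 : ℝ) / 2) * Real.log N ^ (-(2 * c))) :=
            mul_le_mul_of_nonneg_right hii (by positivity)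
        _ = cM / 3 * ((N : ℝ) ^ 2 * Real.log N ^ (-(2 * c))) := by rw [hsplitN]; ring
    -- contradiction: `c_M Q ≤ T(g,g,f₃) ≤ T(Λ,Λ,f₃) + (c_M/3) Q ≤ (2 c_M/3) Q` with `Q > 0`
    have hprod : 0 < cM * ((N : ℝ) ^ 2 * Real.log N ^ (-(2 * c))) := mul_pos hcM hQpos
    linarith
  exact hA h₁ h₂ h₃ hE2 hE4b

end Summit.Parity.GeneralizedHardyLittlewood.Theses.VinogradovHeathBrown
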